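import Literature.AnabelianGeometry.EtaleTheta.SettingModelChiDeltaTheta
import Literature.AnabelianGeometry.EtaleTheta.SettingModelChiTheta
import Literature.AnabelianGeometry.EtaleTheta.KummerDataOfCore
import Literature.AnabelianGeometry.EtaleTheta.SettingModelCycEquivContinuous
import Literature.AnabelianGeometry.EtaleTheta.Discharge.Sec1CompatHolds
import Literature.AnabelianGeometry.EtaleTheta.ConstantMultipleRigidityEquivarianceProofs
import Literature.AnabelianGeometry.EtaleTheta.SettingModelCuspAxis
import Literature.AnabelianGeometry.AbsoluteAnabelian.ZHatCompletionFreeProcyclic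
import Literature.AnabelianGeometry.AbsoluteAnabelian.ZHatCompletionAdicCompleteness
import Literature.AnabelianGeometry.EtaleTheta.SettingModelThetaCentreZHat
import Literature.AnabelianGeometry.EtaleTheta.CyclotomeZHatAction
import HarnessLib

/-!
# The χ-twisted root model of [EtTh] §1 (R78 (B)), file F6: the KUMMER DATA `KummerData.modelχ`

Mochizuki, *The étale theta function …*, Publ. RIMS **45** (2009) [EtTh], §1, Prop. 1.3 / 1.5, PRIMS PDF pp. 21–23
[cite: MochizukiEtTh2009, Prop 1.5 p.23]: "the Kummer map `K^× → H¹(G_K, Δ_Θ)`", "`F² = H¹(G_K, Δ_Θ) →̃ (K^×)^∧`",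
"`log(U) ∈ H¹(Π^tp_Y, Δ_Θ)`, `log(Ü)`", "`log(U)|_Ÿ = 2·log(Ü)`".

Layer L2 of the abc-iut cell, R78 cluster (abc-iut-L2-lead RULINGS #13 R100), file **F6 (c)** = part 2b, seat
abc-iut-w5-d171 (gen 3): the FIRST INHABITANT of `ThetaSetting.KummerData` over a ThetaSetting satisfying the guard
`IsEtThOrigin` — at abc-iut-L2-t1's χ-twisted root model `ThetaSetting.modelχ p` (F5b) — assembled from the tree by
`ThetaSetting.KummerCore.toKummerData` (F6 part 2a, `KummerDataOfCore.lean`):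

* `augTheta := CurveTheta.augTheta (curveχ p)` (abc-iut-L2-d1, `ThetaQuotientsOfCurve`);
* `coeffHom := deltaThetaCoordχ ∘ cycEquiv : Λ(ℚ̄_p^×) ≅ Ẑ ≅ Δ_Θ(modelχ)` (abc-iut-L2-t5's `cycEquiv`, F3c, CONTINUOUS by
  `continuous_cycEquiv`; abc-iut-L6-d6's `deltaThetaCoordχ`, F1c, χ-equivariant by `deltaThetaCoordχ_chi` and
  `cycEquiv_smul`) — so the Kummer maps `kumY`, `kumYdd` ARE the tree's continuous Kummer map, injective by p-adic
  Kummer-faithfulness (F6 part 1 `kummerContMap_injective`);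
* the Galois images `augTheta((Π^tp_Y)^Θ) = G_K`, `augTheta((Π^tp_Ÿ)^Θ) = G_K̈` from the generic root facts
  `map_aug_GtpY` / `map_aug_GtpYdd_eq_GKdd`; `K̈ = K = ℚ_p` since `q_X = p²` (`fieldKN_sq_two_eq`);
* **`log(U)`** := the class of the `y`-COORDINATE crossed homomorphism `g ↦ c^{ŷ(g)}`, `ŷ(g) := ê_b(gfpFst g.left) ∈ Ẑ`
  (abc-iut-w5-d029's `eHatB`), a continuous 1-cocycle on ALL of `(Π^tp_X)^Θ` for the conjugation action on `Δ_Θ`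
  because `ŷ(gh) = ŷ(g) + χ(g)·ŷ(h)` (`eHatB_twist`) matches `g c^t g⁻¹ = c^{χ(g) t}` (`conj_cThetaχ`);
  **`log(Ü)`** := the class of `g ↦ c^{ŷ(g)/2}` on `(Π^tp_Ÿ)^Θ`, where `ŷ` is EVEN (`Δ^tp_{Y_2}`: `y ≡ 0 (2)`) and
  halving `2Ẑ → Ẑ` is the continuous inverse of squaring (`Ẑ` torsion-free); `log(U)|_Ÿ = 2 log(Ü)` on the nose.

HONEST FRAMING: SEMI-SYNTHETIC model (the χ-twisted root, labelled «split-Tate (q Kummer-trivial on the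
ℤ-direction)» by the integrator) — consistency/non-vacuity evidence for the typed interface ONLY; nothing of [EtTh]
is asserted; the `KHat := K^×` field is an honest SUB-object of print's `(K^×)^∧`; no side is taken on [IUTchIII]
Cor. 3.12.  Class (b) construction over the frozen interface (no interface clause touched).
-/

noncomputable section

open CategoryTheory ProfiniteGrp ProfiniteGrp.ProfiniteCompletion Topology

namespace Literature.AnabelianGeometry.EtaleTheta

open Literature.AnabelianGeometry.SemiGraphs

/-! ### Generic complements used by the assembly -/

namespace ThetaSetting

variable {p : ℕ} [Fact p.Prime]

/-- `K(ζ₂, √(r²)) = K` for `r ∈ K`: `K̈ = K₂ = K` when `q_X = r²` is a square in `K`. [cite: MochizukiEtTh2009, §1 p.17] -/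
theorem fieldKN_sq_two_eq (K : IntermediateField ℚ_[p] (PadicAlgCl p)) {r : PadicAlgCl p} (hr : r ∈ K) :
    fieldKN K (r ^ 2) 2 = K := by
  apply le_antisymm
  · rw [fieldKN, IntermediateField.adjoin_le_iff]
    rintro x (hx | hx)
    · exact hx
    · have hx' : x ^ 2 = 1 ∨ x ^ 2 = r ^ 2 := hx
      rcases hx' with h | h
      · rcases sq_eq_one_iff.mp h with rfl | rfl
        · exact K.one_mem
        · exact K.neg_mem K.one_mem
      · rcases sq_eq_sq_iff_eq_or_eq_neg.mp h with rfl | rfl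
        · exact hr
        · exact K.neg_mem hr
  · intro x hx
    exact IntermediateField.subset_adjoin _ _ (Or.inl hx)

variable (D : ThetaSetting p)

/-- `K̈ = K` whenever `q̈ = q_X^{1/2} ∈ K`. [cite: MochizukiEtTh2009, §1 p.17] -/
theorem Kdd_eq_K_of_sqrtqX_mem (h : D.sqrtqX ∈ D.K) : D.Kdd = D.K := by
  rw [Kdd, ← D.sqrtqX_sq]
  exact fieldKN_sq_two_eq D.K h

/-- `K̈/ℚ_p` is finite whenever `q̈ ∈ K`. [cite: MochizukiEtTh2009, §1 p.17] -/
theorem finiteDimensional_Kdd_of_sqrtqX_mem (h : D.sqrtqX ∈ D.K) : FiniteDimensional ℚ_[p] D.Kdd := by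
  rw [D.Kdd_eq_K_of_sqrtqX_mem h]
  exact D.finiteDimensional_K

/-- The Galois image of `(Π^tp_Y)^Θ` under ANY factorisation `ψ` of the augmentation through the theta quotient is
`G_K` (abc-iut-L2-t6's root fact `map_aug_GtpY`). [cite: MochizukiEtTh2009, §1 p.13] -/
theorem map_map_gtpY_of_comp_eq (ψ : D.GtpTheta →* GQp p) (hψ : ψ.comp D.toTheta = D.aug.toMonoidHom) :
    (D.GtpY.map D.toTheta).map ψ = D.K.fixingSubgroup := by
  rw [Subgroup.map_map, hψ]
  exact D.map_aug_GtpY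

/-- … and that of `(Π^tp_Ÿ)^Θ` is `G_K̈` (abc-iut-L2-t9's `map_aug_GtpYdd_eq_GKdd`). [cite: MochizukiEtTh2009, §1 p.17] -/
theorem map_map_gtpYdd_of_comp_eq (ψ : D.GtpTheta →* GQp p) (hψ : ψ.comp D.toTheta = D.aug.toMonoidHom) :
    (D.GtpYdd.map D.toTheta).map ψ = D.Kdd.fixingSubgroup := by
  rw [Subgroup.map_map, hψ]
  exact D.map_aug_GtpYdd_eq_GKdd

end ThetaSetting

namespace SettingModel

/-! ### The `y`-coordinate `ê_b` and the twist; halving in `Ẑ` -/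

/-- **`ê_b (θ_φ x) = φ (ê_b x)`**: the `b`-exponent (the `y`-COORDINATE) is χ-EQUIVARIANT under abc-iut-w5-d024's
twist `θ_φ : a ↦ a, b ↦ b^φ`. [cite: MochizukiEtTh2009, Prop 1.5 p.23] -/
theorem eHatB_twist (φ : MulAut ZH) (x : F₂hatT) : eHatB (twist φ x) = φ (eHatB x) := by
  let φc : ZH →ₜ* ZH :=
    { toMonoidHom := φ.toMonoidHom
      continuous_toFun := (ZHatLevel.continuous_mulEquiv φ).1 }
  let tw : F₂hatT →ₜ* F₂hatT :=
    { toMonoidHom := (twist φ).toMulEquiv.toMonoidHom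
      continuous_toFun := (twist φ).continuous }
  have key : eHatB.comp tw = φc.comp eHatB := by
    refine ext_of_eta ?_ ?_
    · show eHatB (twist φ (eta (FreeGroup.of 0))) = φ (eHatB (eta (FreeGroup.of 0)))
      rw [twist_eta_of_zero, eHatB_eta_of_zero, map_one]
    · show eHatB (twist φ (eta (FreeGroup.of 1))) = φ (eHatB (eta (FreeGroup.of 1)))
      rw [← bPow_iotaZ_one, twist_bPow, eHatB_bPow, eHatB_bPow]
  exact DFunLike.congr_fun key x

/-- The `y`-coordinate of `ĥ_N` is the reduction mod `N` of `ê_b`. [cite: MochizukiEtTh2009, §1 p.12] -/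
theorem hHat_y_eq_modN_eHatB (N : ℕ+) (x : F₂hatT) :
    Multiplicative.ofAdd (hHat N x).y = modN N (eHatB x) := by
  have key : (fun x => Multiplicative.ofAdd (hHat N x).y) = fun x => modN N (eHatB x) := by
    refine denseRange_eta.equalizer ?_ ((modN N).continuous.comp eHatB.continuous) ?_
    · exact (continuous_of_discreteTopology (f := fun h : Heis (ZMod N) => Multiplicative.ofAdd h.y)).comp
        (hHat N).continuous
    · funext g
      simp only [Function.comp_apply, hHat_eta, eHatB_eta, modN_iotaZ, expB_apply, Heis.map_apply,
        Int.coe_castRingHom, toAdd_ofAdd]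
  exact congrFun key x

/-- `(ĥ_N x).y = 0` iff `ê_b x ≡ 0 (N)`. [cite: MochizukiEtTh2009, §1 p.12] -/
theorem hHat_y_eq_zero_iff (N : ℕ+) (x : F₂hatT) : (hHat N x).y = 0 ↔ modN N (eHatB x) = 1 := by
  rw [← hHat_y_eq_modN_eHatB, ofAdd_eq_one]

/-- Squaring `Ẑ → Ẑ` as a homomorphism (`Ẑ` is commutative). [cite: RibesZalesskii2010, Thm 2.7.1] -/
def sqHom : ZH →* ZH where
  toFun t := t ^ 2
  map_one' := one_pow 2
  map_mul' a b := by
    rw [sq, sq, sq, mul_assoc, ← mul_assoc b a b,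
      Literature.AnabelianGeometry.AbsoluteAnabelian.ZHatCompletion.mul_comm b a, mul_assoc, mul_assoc]

/-- [cite: RibesZalesskii2010, Thm 2.7.1] -/
@[simp] theorem sqHom_apply (t : ZH) : sqHom t = t ^ 2 := rfl

/-- Squaring is injective on `Ẑ` (torsion-free, abc-iut-L4). [cite: RibesZalesskii2010, Thm 2.7.1] -/
theorem sqHom_injective : Function.Injective sqHom := by
  intro s t h
  have h1 : sqHom (s * t⁻¹) = 1 := by rw [map_mul, map_inv, h, mul_inv_cancel]
  have h2 : s * t⁻¹ = 1 :=
    Literature.AnabelianGeometry.AbsoluteAnabelian.ZHatCompletion.eq_one_of_pow_eq_one (n := 2) two_ne_zero h1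
  exact mul_inv_eq_one.mp h2

/-- `t ∈ 2Ẑ` iff its level-`2` character vanishes. [cite: RibesZalesskii2010, Thm 2.7.1] -/
theorem mem_range_sqHom_iff (t : ZH) : t ∈ sqHom.range ↔ modN 2 t = 1 := by
  rw [modN_eq_level, ZHatLevel.level_eq_one_iff_exists_pow]
  constructor
  · rintro ⟨s, rfl⟩
    exact ⟨s, rfl⟩
  · rintro ⟨s, hs⟩
    exact ⟨s, hs⟩

/-- `2Ẑ` is stable under every automorphism of `Ẑ`. [cite: RibesZalesskii2010, Thm 2.7.1] -/
theorem mulAut_mem_range_sqHom (φ : MulAut ZH) {t : ZH} (ht : t ∈ sqHom.range) : φ t ∈ sqHom.range := by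
  obtain ⟨s, rfl⟩ := ht
  exact ⟨φ s, by simp [map_pow]⟩

/-- `Ẑ ≃* 2Ẑ` by squaring. [cite: RibesZalesskii2010, Thm 2.7.1] -/
def sqEquiv : ZH ≃* sqHom.range := MonoidHom.ofInjective sqHom_injective

/-- Squaring `Ẑ → 2Ẑ` is a homeomorphism (continuous bijection, compact to Hausdorff). [cite: RibesZalesskii2010, Thm 2.7.1] -/
def sqHomeo : ZH ≃ₜ sqHom.range :=
  Continuous.homeoOfEquivCompactToT2 (f := sqEquiv.toEquiv)
    ((continuous_pow 2).subtype_mk fun t => ⟨t, rfl⟩)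

/-- **Halving** `2Ẑ → Ẑ`, the inverse of squaring. [cite: RibesZalesskii2010, Thm 2.7.1] -/
def half : sqHom.range →* ZH := sqEquiv.symm.toMonoidHom

/-- `(half t)² = t`. [cite: RibesZalesskii2010, Thm 2.7.1] -/
theorem half_sq (t : sqHom.range) : (half t) ^ 2 = (t : ZH) :=
  MonoidHom.apply_ofInjective_symm sqHom_injective t

/-- Halving is continuous. [cite: RibesZalesskii2010, Thm 2.7.1] -/
theorem continuous_half : Continuous half := sqHomeo.symm.continuous

/-- Halving commutes with automorphisms: `half (φ t) = φ (half t)`. [cite: RibesZalesskii2010, Thm 2.7.1] -/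
theorem half_mulAut (φ : MulAut ZH) (t : sqHom.range) :
    half ⟨φ (t : ZH), mulAut_mem_range_sqHom φ t.2⟩ = φ (half t) := by
  apply sqHom_injective
  rw [sqHom_apply, sqHom_apply, half_sq, ← map_pow, half_sq]

variable (p : ℕ) [Fact p.Prime]

/-! ### Instance keys at the concrete carrier (cf. abc-iut-L2-d1's `SettingModelChiLevelKernels`) -/

/-- `Δ_Θ(curveχ)` is commutative — the generic `ThetaSetting.deltaTheta_comm`, RE-KEYED at the concrete quotient
carrier so that instance search finds it (the χ-model is a reducible structure literal, whose projections reduce).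
[cite: MochizukiEtTh2009, §1 p.12] -/
instance deltaThetaχ_isMulCommutative : IsMulCommutative (CurveTheta.thetaToEll (curveχ p)).ker :=
  ThetaSetting.deltaTheta_comm (ThetaSetting.modelχ p)

/-- `Δ_Θ(modelχ) ⊴ (Π^tp_X)^Θ`, keyed on `(modelχ p).DeltaTheta`. [cite: MochizukiEtTh2009, §1 p.12] -/
instance deltaTheta_modelχ_normal : (ThetaSetting.modelχ p).DeltaTheta.Normal :=
  ThetaSetting.deltaTheta_normal _

/-- `Δ_Θ(modelχ)` is commutative, keyed on `(modelχ p).DeltaTheta`. [cite: MochizukiEtTh2009, §1 p.12] -/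
instance deltaTheta_modelχ_isMulCommutative : IsMulCommutative (ThetaSetting.modelχ p).DeltaTheta :=
  ThetaSetting.deltaTheta_comm _

/-! ### The `y`-coordinate crossed homomorphism on `(Π^tp_X)^Θ` -/

/-- `ŷ(g) := ê_b (gfpFst g.left) ∈ Ẑ` on `Π^tp_X = Γ ⋊_χ G_{ℚ_p}`. [cite: MochizukiEtTh2009, Prop 1.5 p.23] -/
def yCoordχ (g : PiTpχ p) : ZH := eHatB (gfpFst g.left)

/-- **`ŷ(gh) = ŷ(g) · χ(g)(ŷ(h))`** — the χ-crossed homomorphism law. [cite: MochizukiEtTh2009, Prop 1.5 p.23] -/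
theorem yCoordχ_mul (g h : PiTpχ p) : yCoordχ p (g * h) = yCoordχ p g * chi p g.right (yCoordχ p h) := by
  unfold yCoordχ
  rw [SemidirectProduct.mul_left, map_mul, map_mul, gfpFst_actχ, actHatχ_apply, eHatB_twist]

/-- `ŷ` is continuous. [cite: MochizukiEtTh2009, Prop 1.5 p.23] -/
theorem continuous_yCoordχ : Continuous (yCoordχ p) :=
  eHatB.continuous.comp (gfpFst.continuous.comp (Semidirect.continuous_left (isInducing_leftRightχ p)))

/-- `ŷ` kills `Ker(Π^tp_X ↠ (Π^tp_X)^Θ)` (all level `y`-coordinates vanish there). [cite: MochizukiEtTh2009, Prop 1.5 p.23] -/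
theorem yCoordχ_eq_one_of_mem_thetaKer {g : PiTpχ p} (hg : g ∈ CurveTheta.thetaKer (curveχ p)) :
    yCoordχ p g = 1 := by
  obtain ⟨h1, -⟩ := (mem_thetaKerχ_iff p g).mp hg
  refine ext_of_modN fun N => ?_
  rw [map_one]
  apply (hHat_y_eq_zero_iff N (gfpFst g.left)).mp
  rw [h1 N]
  rfl

/-- `ŷ` descended to `(Π^tp_X)^Θ`. [cite: MochizukiEtTh2009, Prop 1.5 p.23] -/
def yThetaχ : CurveTheta.GTheta (curveχ p) → ZH :=
  Quotient.lift (yCoordχ p) fun a b hab => by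
    have hab' : a⁻¹ * b ∈ CurveTheta.thetaKer (curveχ p) := QuotientGroup.leftRel_apply.mp hab
    have hb : b = a * (a⁻¹ * b) := by group
    have := yCoordχ_mul p a (a⁻¹ * b)
    rw [← hb, yCoordχ_eq_one_of_mem_thetaKer p hab', map_one, mul_one] at this
    exact this.symm

/-- [cite: MochizukiEtTh2009, Prop 1.5 p.23] -/
@[simp] theorem yThetaχ_toTheta (g : PiTpχ p) : yThetaχ p (CurveTheta.toTheta (curveχ p) g) = yCoordχ p g := rfl

/-- `ŷ` on `(Π^tp_X)^Θ` is continuous (quotient topology). [cite: MochizukiEtTh2009, Prop 1.5 p.23] -/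
theorem continuous_yThetaχ : Continuous (yThetaχ p) :=
  (QuotientGroup.isQuotientMap_mk (CurveTheta.thetaKer (curveχ p))).continuous_iff.mpr (continuous_yCoordχ p)

/-- **The crossed-homomorphism law on `(Π^tp_X)^Θ`**: `ŷ(xy) = ŷ(x) · χ(aug^Θ x)(ŷ(y))`. [cite: MochizukiEtTh2009, Prop 1.5 p.23] -/
theorem yThetaχ_mul (x y : CurveTheta.GTheta (curveχ p)) :
    yThetaχ p (x * y) = yThetaχ p x * chi p (CurveTheta.augTheta (curveχ p) x) (yThetaχ p y) := by
  obtain ⟨g, rfl⟩ := CurveTheta.toTheta_surjective (curveχ p) x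
  obtain ⟨h, rfl⟩ := CurveTheta.toTheta_surjective (curveχ p) y
  rw [← map_mul, yThetaχ_toTheta, yThetaχ_toTheta, yThetaχ_toTheta, CurveTheta.augTheta_toTheta, yCoordχ_mul]
  rfl

/-- **The `log(U)`-cocycle** `g ↦ c^{ŷ(g)} ∈ Δ_Θ` on a subgroup `H ≤ (Π^tp_X)^Θ`. [cite: MochizukiEtTh2009, Prop 1.5 p.23] -/
def logUFunχ (H : Subgroup (CurveTheta.GTheta (curveχ p))) : H → (CurveTheta.thetaToEll (curveχ p)).ker :=
  fun h => deltaThetaCoordχ p (yThetaχ p h)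

/-- It is a continuous 1-cocycle for the conjugation action on `Δ_Θ` (`g c^t g⁻¹ = c^{χ(g)t}` matches
`ŷ(gh) = ŷ(g) + χ(g) ŷ(h)`). [cite: MochizukiEtTh2009, Prop 1.5 p.23] -/
theorem logUFunχ_mem (H : Subgroup (CurveTheta.GTheta (curveχ p))) :
    logUFunχ p H ∈ contCocycles (MonoidHom.id (CurveTheta.GTheta (curveχ p)))
      (CurveTheta.thetaToEll (curveχ p)).ker H := by
  refine ⟨(continuous_deltaThetaCoordχ p).comp ((continuous_yThetaχ p).comp continuous_subtype_val),
    fun g h => ?_⟩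
  show deltaThetaCoordχ p (yThetaχ p ((g : CurveTheta.GTheta (curveχ p)) * h)) =
    deltaThetaCoordχ p (yThetaχ p g) *
      MulAut.conjNormal ((MonoidHom.id _) (g : CurveTheta.GTheta (curveχ p))) (deltaThetaCoordχ p (yThetaχ p h))
  rw [yThetaχ_mul, map_mul, MonoidHom.id_apply, ← deltaThetaCoordχ_chi]

/-- On `(Π^tp_Ÿ)^Θ` the `y`-coordinate is EVEN (`Δ^tp_{Y_2}`: `y ≡ 0 (2)`). [cite: MochizukiEtTh2009, Prop 1.5 p.23] -/
theorem yThetaχ_mem_range_sqHom {x : CurveTheta.GTheta (curveχ p)}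
    (hx : x ∈ (ThetaSetting.modelχ p).GtpYdd.map (ThetaSetting.modelχ p).toTheta) : yThetaχ p x ∈ sqHom.range := by
  obtain ⟨g, hg, rfl⟩ := hx
  have hg2 : g ∈ YNχ p 2 := by
    have h' : g ∈ (ThetaSetting.modelχ p).GtpYN (2 * 1) := (Subgroup.mem_inf.mp hg).1
    simpa using h'
  have hy : (levelHom 2 g.left).y = 0 := ((Subgroup.mem_inf.mp ((GfpTwistData.mem_YN _).mp hg2).1).2).2
  show yCoordχ p g ∈ sqHom.range
  rw [mem_range_sqHom_iff]
  exact (hHat_y_eq_zero_iff 2 (gfpFst g.left)).mp hy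

/-- **The `log(Ü)`-cocycle** `g ↦ c^{ŷ(g)/2}` on `(Π^tp_Ÿ)^Θ`. [cite: MochizukiEtTh2009, Prop 1.5 p.23] -/
def logUddFunχ : ((ThetaSetting.modelχ p).GtpYdd.map (ThetaSetting.modelχ p).toTheta) →
    (CurveTheta.thetaToEll (curveχ p)).ker :=
  fun h => deltaThetaCoordχ p (half ⟨yThetaχ p h, yThetaχ_mem_range_sqHom p h.2⟩)

/-- It is a continuous 1-cocycle. [cite: MochizukiEtTh2009, Prop 1.5 p.23] -/
theorem logUddFunχ_mem :
    logUddFunχ p ∈ contCocycles (MonoidHom.id (CurveTheta.GTheta (curveχ p)))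
      (CurveTheta.thetaToEll (curveχ p)).ker ((ThetaSetting.modelχ p).GtpYdd.map (ThetaSetting.modelχ p).toTheta) := by
  refine ⟨(continuous_deltaThetaCoordχ p).comp (continuous_half.comp
    (((continuous_yThetaχ p).comp continuous_subtype_val).subtype_mk _)), fun g h => ?_⟩
  show deltaThetaCoordχ p (half ⟨yThetaχ p ((g : CurveTheta.GTheta (curveχ p)) * h), _⟩) =
    deltaThetaCoordχ p (half ⟨yThetaχ p g, _⟩) *
      MulAut.conjNormal ((MonoidHom.id _) (g : CurveTheta.GTheta (curveχ p))) (deltaThetaCoordχ p (half ⟨yThetaχ p h, _⟩))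
  rw [MonoidHom.id_apply, ← deltaThetaCoordχ_chi, ← map_mul, ← half_mulAut, ← map_mul]
  congr 1
  apply sqHom_injective
  rw [sqHom_apply, sqHom_apply, half_sq, half_sq]
  exact yThetaχ_mul p g h

/-- **`log(U) ∈ H¹((Π^tp_Y)^Θ, Δ_Θ)`** at the χ-model: the class of the `y`-coordinate cocycle.
[cite: MochizukiEtTh2009, Prop 1.5 p.23] -/
def logUχ : (ThetaSetting.modelχ p).H1Theta ((ThetaSetting.modelχ p).GtpY.map (ThetaSetting.modelχ p).toTheta) :=
  ContH1.mk (logUFunχ p _) (logUFunχ_mem p _)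

/-- **`log(Ü) ∈ H¹((Π^tp_Ÿ)^Θ, Δ_Θ)`** at the χ-model: the class of the halved `y`-coordinate cocycle.
[cite: MochizukiEtTh2009, Prop 1.5 p.23] -/
def logUddχ : (ThetaSetting.modelχ p).H1Theta ((ThetaSetting.modelχ p).GtpYdd.map (ThetaSetting.modelχ p).toTheta) :=
  ContH1.mk (logUddFunχ p) (logUddFunχ_mem p)

/-- **`log(U)|_Ÿ = 2 · log(Ü)`** at the χ-model (on cocycles: `c^{ŷ} = (c^{ŷ/2})²`). [cite: MochizukiEtTh2009, Prop 1.5 p.23] -/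
theorem res_logUχ :
    ContH1.res (MonoidHom.id (ThetaSetting.modelχ p).GtpTheta) (ThetaSetting.modelχ p).DeltaTheta
        (ThetaSetting.modelχ p).GtpYddTheta_le (logUχ p) = logUddχ p ^ 2 := by
  rw [logUddχ, pow_two, ContH1.mk_mul_mk]
  refine ContH1.mk_congr _ (funext fun h => ?_) _ _
  show deltaThetaCoordχ p (yThetaχ p h) =
    deltaThetaCoordχ p (half ⟨yThetaχ p h, _⟩) * deltaThetaCoordχ p (half ⟨yThetaχ p h, _⟩)
  rw [← map_mul, ← pow_two, half_sq]

/-! ### The Kummer core and the Kummer data of the χ-model -/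

/-- **The Kummer core of the χ-twisted root model.** [cite: MochizukiEtTh2009, Prop 1.5 p.23] -/
def kummerCoreχ : (ThetaSetting.modelχ p).KummerCore where
  augTheta := CurveTheta.augTheta (curveχ p)
  continuous_augTheta := CurveTheta.continuous_augTheta (curveχ p)
  augTheta_toTheta g := rfl
  coeffHom := (deltaThetaCoordχ p).comp (cycEquiv p).toMonoidHom
  continuous_coeffHom := (continuous_deltaThetaCoordχ p).comp (continuous_cycEquiv p)
  coeffHom_smul g ζ := by
    show deltaThetaCoordχ p (cycEquiv p (CurveTheta.augTheta (curveχ p) g • ζ)) =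
      MulAut.conjNormal g (deltaThetaCoordχ p (cycEquiv p ζ))
    rw [cycEquiv_smul, deltaThetaCoordχ_chi]
  bijective_coeffHom := (bijective_deltaThetaCoordχ p).comp (cycEquiv p).bijective
  map_augTheta_gtpY :=
    (ThetaSetting.modelχ p).map_map_gtpY_of_comp_eq _ (CurveTheta.augTheta_comp_toTheta (curveχ p))
  map_augTheta_gtpYdd :=
    (ThetaSetting.modelχ p).map_map_gtpYdd_of_comp_eq _ (CurveTheta.augTheta_comp_toTheta (curveχ p))
  finiteDimensional_Kdd :=
    (ThetaSetting.modelχ p).finiteDimensional_Kdd_of_sqrtqX_mem (natCast_mem ⊥ p)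
  logU := logUχ p
  logUdd := logUddχ p
  res_logU := res_logUχ p

/-- **The Kummer data of the χ-twisted root model** — the first inhabitant of `ThetaSetting.KummerData` at a
setting satisfying `IsEtThOrigin`. [cite: MochizukiEtTh2009, Prop 1.5 p.23] -/
def kummerDataχ : (ThetaSetting.modelχ p).KummerData := (kummerCoreχ p).toKummerData

/-- `KummerData(modelχ)` is inhabited (the E-indexed Kummer block of [EtTh] §1 is non-vacuous at a setting with
`IsEtThOrigin`; contrast: it is EMPTY at the untwisted root `ThetaSetting.model p`, `model_isEmpty_kummerData`).
[cite: MochizukiEtTh2009, Prop 1.5 p.23] -/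
theorem nonempty_kummerData_modelχ : Nonempty (ThetaSetting.modelχ p).KummerData := ⟨kummerDataχ p⟩

/-- The Kummer map of `KummerData(modelχ)` is the tree's continuous Kummer map with coefficients
`Λ(ℚ̄_p^×) ≅ Ẑ ≅ Δ_Θ`. [cite: MochizukiEtTh2009, Prop 1.5 p.23] -/
theorem kummerDataχ_kumY (x : (kummerCoreχ p).invY) :
    (kummerDataχ p).kumY x =
      (letI := (ThetaSetting.modelχ p).unitsAction (kummerCoreχ p).augTheta
       (kummerCoreχ p).coeff.kummerContMap _ (kummerCoreχ p).isOpen_stabilizer' x) :=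
  rfl

end SettingModel

end Literature.AnabelianGeometry.EtaleTheta

end
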